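import Mathlib
import Summits.FinalStateConjecture.FinalStateConjecture.Theorems.EternalPapapetrouSchwarzschildExteriorModeRigidityJets
import HarnessLib

/-!
# Route EternalPapapetrou · SchwarzschildExteriorModeRigidity — time convolution of jets

Helper file for item stmt-FinalStateConjecture-10039 (`SchwarzschildExteriorModeRigidity`).

Time convolution with an integrable kernel `k` maps a jet of the reduced system with
uniform-in-`t` bounds on compact `r`-ranges to another such jet, componentwise
(`RWJet.timeConvJet`, `RWJet.Bounds.timeConvJet`): differentiation under the integral sign
(dominated by the strip bounds), continuity of the convolved second partials, and commutation of
the reduced operator with `timeConv`. [folklore]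
-/

set_option linter.dupNamespace false

noncomputable section

namespace Summit.FinalStateConjecture.FinalStateConjecture.Theorems

open MeasureTheory Set Filter Topology Metric

namespace EternalPapapetrou.ModeRigidity

variable {E : Type*} [NormedAddCommGroup E] [NormedSpace ℝ E] [CompleteSpace E]

omit [CompleteSpace E] in
/-- `timeConv` commutes with `L₁`. [folklore] -/
theorem timeConv_L₁ {k : ℝ → ℝ} {X Y : ℝ × ℝ → E} {p : ℝ × ℝ}
    (hX : Integrable fun s ↦ k s • X (p.1 - s, p.2))
    (hY : Integrable fun s ↦ k s • Y (p.1 - s, p.2)) :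
    timeConv k (fun q ↦ L₁ (X q) (Y q)) p = L₁ (timeConv k X p) (timeConv k Y p) := by
  have hL : ∀ s, k s • L₁ (X (p.1 - s, p.2)) (Y (p.1 - s, p.2)) =
      L₁ (k s • X (p.1 - s, p.2)) (k s • Y (p.1 - s, p.2)) := fun s ↦
    ContinuousLinearMap.ext fun v ↦ by simp [L₁, smul_smul, mul_comm]
  have hi : Integrable fun s ↦ k s • L₁ (X (p.1 - s, p.2)) (Y (p.1 - s, p.2)) := by
    have hA := (ContinuousLinearMap.smulRightL ℝ (ℝ × ℝ) E
      (ContinuousLinearMap.fst ℝ ℝ ℝ)).integrable_comp hX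
    have hB := (ContinuousLinearMap.smulRightL ℝ (ℝ × ℝ) E
      (ContinuousLinearMap.snd ℝ ℝ ℝ)).integrable_comp hY
    refine (hA.add hB).congr (Eventually.of_forall fun s ↦ ?_)
    show _ = k s • L₁ (X (p.1 - s, p.2)) (Y (p.1 - s, p.2))
    rw [hL]
    exact ContinuousLinearMap.ext fun v ↦ by simp [L₁, smul_smul, mul_comm]
  rw [timeConv_eq]
  apply ContinuousLinearMap.ext fun v ↦ ?_
  rw [ContinuousLinearMap.integral_apply hi]
  simp only [hL, L₁_apply, timeConv_eq]
  rw [integral_add ?_ ?_, integral_smul, integral_smul]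
  · exact hX.smul v.1
  · exact hY.smul v.2

namespace RWJet

variable {M : ℝ} {Λ : E →L[ℝ] E}

omit [CompleteSpace E] in
/-- The ball of radius `(r₀ − 2M)/2` around a point of the strip stays in the strip, with
`r`-coordinate in `[r₀ − ε, r₀ + ε]`. [folklore] -/
theorem ball_strip {M : ℝ} {p₀ : ℝ × ℝ} (q : ℝ × ℝ)
    (hq : dist q p₀ < (p₀.2 - 2 * M) / 2) :
    q.2 ∈ Icc (p₀.2 - (p₀.2 - 2 * M) / 2) (p₀.2 + (p₀.2 - 2 * M) / 2) ∧ q.2 ∈ Ioi (2 * M) := by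
  have h2 := abs_lt.1 (abs_snd_sub_lt_of_dist_lt hq)
  refine ⟨⟨by linarith, by linarith⟩, ?_⟩
  show 2 * M < q.2
  linarith

/-- **Time convolution of a bounded jet with an integrable kernel is a jet.** [folklore] -/
def timeConvJet (J : RWJet M Λ) (B : J.Bounds) {k : ℝ → ℝ} (hk : Integrable k) : RWJet M Λ where
  V := timeConv k J.V
  Vt := timeConv k J.Vt
  Vr := timeConv k J.Vr
  Vtt := timeConv k J.Vtt
  Vtr := timeConv k J.Vtr
  Vrr := timeConv k J.Vrr
  hasFDerivAt := by
    intro p₀ hp₀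
    have hε : 0 < (p₀.2 - 2 * M) / 2 := by have := hp₀.2; simp only [mem_Ioi] at this; linarith
    obtain ⟨C, hC⟩ : ∃ C, ∀ q : ℝ × ℝ,
        q.2 ∈ Icc (p₀.2 - (p₀.2 - 2 * M) / 2) (p₀.2 + (p₀.2 - 2 * M) / 2) →
        ‖J.V q‖ ≤ C ∧ ‖J.Vt q‖ ≤ C ∧ ‖J.Vr q‖ ≤ C :=
      ⟨_, fun q hq ↦ let h := B.le _ _ (by linarith) (by linarith) q hq; ⟨h.1, h.2.1, h.2.2.1⟩⟩
    have hC0 : 0 ≤ C := (norm_nonneg _).trans (hC p₀ ⟨by linarith, by linarith⟩).1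
    have key := hasFDerivAt_timeConv hk J.continuousOn J.hasFDerivAt
      (continuous_L₁.comp_continuousOn (J.continuousOn_t.prodMk J.continuousOn_r))
      (C := C + C) hε (fun q hq ↦ (ball_strip q hq).2) (fun s _ q hq ↦ ?_)
    · refine key.congr_fderiv (timeConv_L₁ ?_ ?_)
      · exact integrable_timeConv_integrand hk J.continuousOn_t hp₀.2
          fun s _ ↦ (hC _ ⟨by linarith, by linarith⟩).2.1
      · exact integrable_timeConv_integrand hk J.continuousOn_r hp₀.2
          fun s _ ↦ (hC _ ⟨by linarith, by linarith⟩).2.2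
    · obtain ⟨h0, h1, h2⟩ := hC (q.1 - s, q.2) (ball_strip q hq).1
      exact ⟨by linarith, (norm_L₁_le _ _).trans (by linarith)⟩
  hasFDerivAt_t := by
    intro p₀ hp₀
    have hε : 0 < (p₀.2 - 2 * M) / 2 := by have := hp₀.2; simp only [mem_Ioi] at this; linarith
    obtain ⟨C, hC⟩ : ∃ C, ∀ q : ℝ × ℝ,
        q.2 ∈ Icc (p₀.2 - (p₀.2 - 2 * M) / 2) (p₀.2 + (p₀.2 - 2 * M) / 2) →
        ‖J.Vt q‖ ≤ C ∧ ‖J.Vtt q‖ ≤ C ∧ ‖J.Vtr q‖ ≤ C :=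
      ⟨_, fun q hq ↦ let h := B.le _ _ (by linarith) (by linarith) q hq;
        ⟨h.2.1, h.2.2.2.1, h.2.2.2.2.1⟩⟩
    have hC0 : 0 ≤ C := (norm_nonneg _).trans (hC p₀ ⟨by linarith, by linarith⟩).1
    have key := hasFDerivAt_timeConv hk J.continuousOn_t J.hasFDerivAt_t
      (continuous_L₁.comp_continuousOn (J.cont_tt.prodMk J.cont_tr))
      (C := C + C) hε (fun q hq ↦ (ball_strip q hq).2) (fun s _ q hq ↦ ?_)
    · refine key.congr_fderiv (timeConv_L₁ ?_ ?_)
      · exact integrable_timeConv_integrand hk J.cont_tt hp₀.2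
          fun s _ ↦ (hC _ ⟨by linarith, by linarith⟩).2.1
      · exact integrable_timeConv_integrand hk J.cont_tr hp₀.2
          fun s _ ↦ (hC _ ⟨by linarith, by linarith⟩).2.2
    · obtain ⟨h0, h1, h2⟩ := hC (q.1 - s, q.2) (ball_strip q hq).1
      exact ⟨by linarith, (norm_L₁_le _ _).trans (by linarith)⟩
  hasFDerivAt_r := by
    intro p₀ hp₀
    have hε : 0 < (p₀.2 - 2 * M) / 2 := by have := hp₀.2; simp only [mem_Ioi] at this; linarith
    obtain ⟨C, hC⟩ : ∃ C, ∀ q : ℝ × ℝ,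
        q.2 ∈ Icc (p₀.2 - (p₀.2 - 2 * M) / 2) (p₀.2 + (p₀.2 - 2 * M) / 2) →
        ‖J.Vr q‖ ≤ C ∧ ‖J.Vtr q‖ ≤ C ∧ ‖J.Vrr q‖ ≤ C :=
      ⟨_, fun q hq ↦ let h := B.le _ _ (by linarith) (by linarith) q hq;
        ⟨h.2.2.1, h.2.2.2.2.1, h.2.2.2.2.2⟩⟩
    have hC0 : 0 ≤ C := (norm_nonneg _).trans (hC p₀ ⟨by linarith, by linarith⟩).1
    have key := hasFDerivAt_timeConv hk J.continuousOn_r J.hasFDerivAt_r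
      (continuous_L₁.comp_continuousOn (J.cont_tr.prodMk J.cont_rr))
      (C := C + C) hε (fun q hq ↦ (ball_strip q hq).2) (fun s _ q hq ↦ ?_)
    · refine key.congr_fderiv (timeConv_L₁ ?_ ?_)
      · exact integrable_timeConv_integrand hk J.cont_tr hp₀.2
          fun s _ ↦ (hC _ ⟨by linarith, by linarith⟩).2.1
      · exact integrable_timeConv_integrand hk J.cont_rr hp₀.2
          fun s _ ↦ (hC _ ⟨by linarith, by linarith⟩).2.2
    · obtain ⟨h0, h1, h2⟩ := hC (q.1 - s, q.2) (ball_strip q hq).1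
      exact ⟨by linarith, (norm_L₁_le _ _).trans (by linarith)⟩
  cont_tt := continuousOn_timeConv hk J.cont_tt fun a b ha hb ↦
    ⟨B.C a b, fun p hp ↦ (B.le a b ha hb p hp).2.2.2.1⟩
  cont_tr := continuousOn_timeConv hk J.cont_tr fun a b ha hb ↦
    ⟨B.C a b, fun p hp ↦ (B.le a b ha hb p hp).2.2.2.2.1⟩
  cont_rr := continuousOn_timeConv hk J.cont_rr fun a b ha hb ↦
    ⟨B.C a b, fun p hp ↦ (B.le a b ha hb p hp).2.2.2.2.2⟩
  pde := by
    intro p hp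
    have hb := fun s ↦ B.le p.2 p.2 hp.2 le_rfl (p.1 - s, p.2) ⟨le_rfl, le_rfl⟩
    rw [rwOp_timeConv M Λ hk (continuous_slice J.continuousOn p.1 hp.2)
      (continuous_slice J.continuousOn_t p.1 hp.2) (continuous_slice J.continuousOn_r p.1 hp.2)
      (continuous_slice J.cont_tt p.1 hp.2) (continuous_slice J.cont_tr p.1 hp.2)
      (continuous_slice J.cont_rr p.1 hp.2) (fun s _ ↦ (hb s).1) (fun s _ ↦ (hb s).2.1)
      (fun s _ ↦ (hb s).2.2.1) (fun s _ ↦ (hb s).2.2.2.1) (fun s _ ↦ (hb s).2.2.2.2.1)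
      (fun s _ ↦ (hb s).2.2.2.2.2)]
    rw [timeConv_congr k (W := fun _ ↦ (0 : E)) fun τ ↦ J.pde (τ, p.2) ⟨mem_univ _, hp.2⟩]
    exact timeConv_zero_fun k p

/-- The strip bounds of the convolved jet. [folklore] -/
def Bounds.timeConvJet {J : RWJet M Λ} (B : J.Bounds) {k : ℝ → ℝ} (hk : Integrable k) :
    (J.timeConvJet B hk).Bounds where
  C a b := (∫ s, ‖k s‖) * B.C a b
  le := by
    intro a b ha hab p hp
    have h := fun τ ↦ B.le a b ha hab (τ, p.2) hp
    exact ⟨norm_timeConv_le hk fun τ ↦ (h τ).1, norm_timeConv_le hk fun τ ↦ (h τ).2.1,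
      norm_timeConv_le hk fun τ ↦ (h τ).2.2.1, norm_timeConv_le hk fun τ ↦ (h τ).2.2.2.1,
      norm_timeConv_le hk fun τ ↦ (h τ).2.2.2.2.1, norm_timeConv_le hk fun τ ↦ (h τ).2.2.2.2.2⟩

end RWJet

end EternalPapapetrou.ModeRigidity

end Summit.FinalStateConjecture.FinalStateConjecture.Theorems
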